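import Summits.Parity.GeneralizedHardyLittlewood.Theses.ZDegreeToeplitzBand
import Literature.NumberTheory.LFunctions.Zhang2022.KnifeEdgeLenZDegreeShortDensePiece

/-!
# Route `ZDegreeToeplitzBand` — darkness PORT of `ShortPairsTauTwoDark` (stmt-Parity-20429) over the REPAIRED side tables
# `InClassSideTablesPiece`: the item from K0 (repaired) + x₂-darkness on polynomial short pairs

Toeplitz CLOSURE SQUAD (i) (cell landau-siegel §D, WAVE-2 chain #1; ls-lead WAVE2-INPUT v1.0 87bec0cb73599e09 §1a,
director-frontier 13:20:35Z 2026-08-27), `_piece` RE-THREAD after the tenure ruling on K0 (ls-knife-plan g1 14:08:24Z: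
stmt-Parity-20016 `InClassSideTables` misstated as typed; repaired item `InClassSideTablesPiece` = `∃ c₀, ∀ c′ ≥ c₀,
KnifeEdge.InClassMeanPiece c′`, route rev ≥ 7, `closes (h0 : InClassSideTablesPiece) …`). The item stmt-Parity-20429 `ShortPairsTauTwoDark` is
reduced BY KERNEL THEOREM to:

* the REPAIRED K0 = `InClassSideTablesPiece` (OPEN item — a hypothesis here), and
* x₂-DARKNESS ON POLYNOMIAL SHORT PAIRS (or on any sub-class `𝒞₀ ⊇ KnifeEdge.PolyShortPairs`), eventually in `c′`, allowed
  to use the repaired K0 at the same `c′`: `∃ c₀, ∀ c′ ≥ c₀, InClassMeanPiece c′ → CrossTablePsiOn c′ 𝒞₀ 2 0` — the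
  desk-derived content of the K1″a hand's DISPLAY #3 (K1A-DISPLAY-3-Daudit v1.0a 24fccd0f8afb1eb3; theory PASS-WITH-NOTES 10:41:08Z, crit-1 PASS-AS-COUNT 10:34:08Z), OPEN in the kernel and asserted by no one (a hypothesis here, spelled in
  existing vocabulary).

Kernel content: `Literature/NumberTheory/LFunctions/Zhang2022/KnifeEdgeLenZDegreeShortPolyDense.lean` (p536434: the (D11″)
density leg `KnifeEdge.exists_polyShortPairs_approx` PROVED) and `…/KnifeEdgeLenZDegreeShortDensePiece.lean` (the `_piece`
twins of the density reductions and ports, `KnifeEdge.tauTwoDarkShort_eventually_of_poly_piece`). Conditional by design (a port, not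
a closing): `--supports stmt-Parity-20429`. Standard axioms.

«The programme SEARCHES and TYPES; no claim about Landau–Siegel zeros, Theorems 1–2 of arXiv:2211.02515 or a repaired
Margin232 until a kernel theorem says so.»

## References
* [Zhang2022LandauSiegel] Y. Zhang, Discrete mean estimates and the Landau–Siegel zero, arXiv:2211.02515v1 (2022):
  §2 (2.17) / Lemma 2.3, §4 Lemma 4.8 p. 9, §7 Prop. 7.1 / (7.2) p. 13, §8 (8.5) / Lemma 8.1 / Lemma 8.2 p. 16, (8.23).
-/

namespace Summit.Parity.GeneralizedHardyLittlewood.Theorems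

open Literature.NumberTheory.LFunctions.Zhang2022
open Literature.NumberTheory.LFunctions.Zhang2022.KnifeEdge
open Literature.NumberTheory.LFunctions.Zhang2022.Skeleton
open Summit.Parity.GeneralizedHardyLittlewood.Theses.ZDegreeToeplitzBand

/-- **PORT of stmt-Parity-20429 over the repaired K0 (general sub-class).** `InClassSideTablesPiece` and x₂-darkness, eventually in
`c′`, on a sub-class `𝒞₀` containing the polynomial short pairs ⇒ `ShortPairsTauTwoDark`.
[cite: Zhang2022LandauSiegel, §2 Lemma 2.3, §8 (8.5) Lemma 8.1 Lemma 8.2 p.16] -/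
theorem shortPairsTauTwoDark_of_sideTablesPiece_of_dark {𝒞₀ : PairClass}
    (h𝒞₀ : ∀ f f' g g', PolyShortPairs f f' g g' → 𝒞₀ f f' g g') (h0 : InClassSideTablesPiece)
    (hd : ∃ c₀ : ℝ, ∀ c' : ℝ, c₀ ≤ c' → InClassMeanPiece c' → CrossTablePsiOn c' 𝒞₀ 2 (fun _ _ _ _ => 0)) :
    ShortPairsTauTwoDark :=
  tauTwoDarkShort_eventually_of_poly_piece h𝒞₀ h0 hd

/-- **PORT of stmt-Parity-20429 over the repaired K0 (polynomial short pairs).** [cite: Zhang2022LandauSiegel, §2 Lemma 2.3, §8 (8.5) Lemma 8.1 Lemma 8.2 p.16] -/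
theorem shortPairsTauTwoDark_of_sideTablesPiece_of_polyDark (h0 : InClassSideTablesPiece)
    (hd : ∃ c₀ : ℝ, ∀ c' : ℝ, c₀ ≤ c' → InClassMeanPiece c' → CrossTablePsiOn c' PolyShortPairs 2 (fun _ _ _ _ => 0)) :
    ShortPairsTauTwoDark :=
  shortPairsTauTwoDark_of_sideTablesPiece_of_dark (fun _ _ _ _ h => h) h0 hd

/-- The same with an UNCONDITIONAL darkness hypothesis (not using K0 at `c′`).
[cite: Zhang2022LandauSiegel, §2 Lemma 2.3, §8 (8.5) Lemma 8.1 Lemma 8.2 p.16] -/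
theorem shortPairsTauTwoDark_of_sideTablesPiece_of_polyDark' (h0 : InClassSideTablesPiece)
    (hd : ∃ c₀ : ℝ, ∀ c' : ℝ, c₀ ≤ c' → CrossTablePsiOn c' PolyShortPairs 2 (fun _ _ _ _ => 0)) :
    ShortPairsTauTwoDark := by
  obtain ⟨c₀, hd⟩ := hd
  exact shortPairsTauTwoDark_of_sideTablesPiece_of_polyDark h0 ⟨c₀, fun c' hc' _ => hd c' hc'⟩

end Summit.Parity.GeneralizedHardyLittlewood.Theorems
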